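import Literature.AlgebraicGeometry.Frobenioids.PadicFrobenioidRmk122Necessity
import Literature.AlgebraicGeometry.Frobenioids.PadicFrobenioidSubfunctor
import Literature.AlgebraicGeometry.Frobenioids.PadicFrobenioidQp
import HarnessLib

/-!
# Frobenioids II, Remark 1.2.2: an absolutely primitive datum with a NON-surjective pull-back of `Φ` —
# the printed (hypothesis-free) sentences 3 and 4 are false as stated (proof-only witness)

Mochizuki, *The geometry of Frobenioids II: poly-Frobenioids*, Kyushu J. Math. **62** (2008) 401–460,
§1, Example 1.1 (ii) p. 8 ("Let `D` be any connected, totally epimorphic category that admits a functor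
`D → D₀`, and `Φ ⊆ Φ₀^Λ|_D` a monoprime subfunctor in monoids …") and Remark 1.2.2 p. 10 ("Suppose that `Φ`
is absolutely primitive, and that `Λ = ℤ` … `u_D` determines a new characteristic splitting `u_D · τ` …
one obtains a unique automorphism `U` …"). [cite: MochizukiFrdII2008, Rmk 1.2.2 p.10]

PROOF-ONLY companion (abc-iut cell, seat abc-iut-f-046; no `def`: the witness is built inside the proofs
from abc-iut-L1's GENERIC constructor `SubDatum.toDatum`).  It supplies the NON-VACUITY half of cell
FINDING T4g2-F1 (abc-iut-L1-t4 gen 2, module docstring of `PadicFrobenioidRmk122.lean`: "hand witness"),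
whose abstract half is `PadicFrobenioidRmk122Necessity.lean`:

* `exists_isAbsolutelyPrimitive_not_surjective` — over the two-object base `D = {0 → 1}` (the preorder
  `Fin 2`; connected, totally epimorphic), constant base functor `Spec ℚ_p`, the subfunctor
  `Φ(a) := 2^a · ℤ_{≥0} · ord(p) ⊆ Φ₀` (`Φ(0) = ℤ_{≥0}·ord(p) ⊋ Φ(1) = 2ℤ_{≥0}·ord(p)`; monoprime, stable,
  nonzero) gives via `SubDatum.toDatum` an ABSOLUTELY PRIMITIVE `p`-adic Frobenioid datum whose pull-back
  `Φ(1) → Φ(0)` along `0 → 1` is NOT surjective ("the generator of `Φ(A_D) ≅ ℤ_{≥0}` changes degree along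
  an arrow of `D`", loc. cit.);
* `exists_isAbsolutelyPrimitive_not_rmk122` — hence (by `not_rmk122Twist_of_not_surjective`,
  `not_rmk122U_of_not_surjective`) for this datum, its `(1 + p)`-section `u_D` and the splitting `τ_p` of
  Thm. 1.2 (v): `u_D · τ_p` is NOT a characteristic splitting and NO morphism of the data is the identity on
  `O^×(−)` while mapping `τ_p` to `u_D · τ_p`;
* `not_forall_rmk122Twist_asPrinted`, `not_forall_rmk122U_asPrinted` — the HYPOTHESIS-FREE readings of
  sentences 3 and 4 (all absolutely primitive data, all sections, all characteristic splittings), i.e. the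
  typed `Rmk122TwistOfBijective` / `Rmk122UOfBijective` with the (R1) binder deleted, are FALSE (closed
  form, at `p = 2`).  With `PadicFrobenioidRmk122Necessity.lean`: (R1) is exactly the missing hypothesis.

HONEST FRAMING: this certifies a reading finding about a Remark of a refereed preparatory paper under the
cell's typing of [FrdI] Def. 2.3 (subfunctoriality along linear morphisms); it is recorded for the referee
bundle, not as a defect claim beyond that reading; [FrdII] Rmk 1.2.2 is outside the [IUTchIII] Cor. 3.12
cone; no side taken; typed ≠ proved elsewhere.
-/

namespace Literature.AlgebraicGeometry.Frobenioids

namespace PadicFrd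

open CategoryTheory Opposite Function

section Witness

variable (p : ℕ) [Fact p.Prime]

/-- **An absolutely primitive `p`-adic Frobenioid datum with a non-surjective pull-back of `Φ`**: base
`D = Fin 2 = {0 → 1}` over the constant `Spec ℚ_p`, `Φ(a) = 2^a · ℤ_{≥0} · ord(p)`; the pull-back of `Φ` along
`0 → 1` is the proper inclusion `2ℤ_{≥0} · ord(p) ⊊ ℤ_{≥0} · ord(p)`. [cite: MochizukiFrdII2008, Ex 1.1 (ii) p.8] -/
theorem exists_isAbsolutelyPrimitive_not_surjective :
    ∃ d : Datum (Fin 2) p, d.IsAbsolutelyPrimitive ∧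
      ¬ Surjective (d.Φ.map (homOfLE (Fin.zero_le (1 : Fin 2))).op).hom := by
  classical
  let base : Fin 2 ⥤ PadicFld.{0} p := (Functor.const (Fin 2)).obj (qpFld p)
  have hloc : ∀ A : Fin 2, (base.obj A).IsPadicLocal := fun _ => isPadicLocal_qpFld p
  have hc : IsConnected (Fin 2) := zigzag_isConnected fun j₁ j₂ => by
    rcases le_total j₁ j₂ with h | h
    · exact Relation.ReflTransGen.single (Or.inl ⟨homOfLE h⟩)
    · exact Relation.ReflTransGen.single (Or.inr ⟨homOfLE h⟩)
  have he : IsTotallyEpimorphic (Fin 2) := ⟨fun _ => ⟨fun g h _ => Subsingleton.elim g h⟩⟩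
  have hinj : ∀ A : Fin 2, Injective fun m : ℕ => primGen base A ^ m := fun A =>
    primGen_pow_injective base (hloc A)
  -- the subfunctor `Φ(a) = 2^a · ℤ_{≥0} · ord(p)`
  let T : SubDatum base :=
    { S := fun A => Submonoid.powers (primGen base A ^ 2 ^ A.val)
      map_mem := fun {A A'} f x hx => by
        obtain ⟨m, rfl⟩ := hx
        have hle : A'.unop.val ≤ A.unop.val := f.unop.le
        refine ⟨2 ^ (A.unop.val - A'.unop.val) * m, ?_⟩
        show (primGen base A'.unop ^ 2 ^ A'.unop.val) ^ (2 ^ (A.unop.val - A'.unop.val) * m) =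
          phi0Map base f ((primGen base A.unop ^ 2 ^ A.unop.val) ^ m)
        rw [map_pow, map_pow, phi0Map_primGen, ← pow_mul, ← pow_mul, ← mul_assoc, ← pow_add,
          Nat.add_sub_cancel' hle]
      isMonoprime := fun A => by
        have hinjA : Injective fun m : ℕ => (primGen base A ^ 2 ^ A.val) ^ m := fun m m' h => by
          have h' : primGen base A ^ (2 ^ A.val * m) = primGen base A ^ (2 ^ A.val * m') := by
            rw [pow_mul, pow_mul]
            exact h
          exact Nat.eq_of_mul_eq_mul_left (Nat.two_pow_pos _) (hinj A h')
        exact IsMonoprime.ofZ ⟨⟨(Submonoid.powLogEquiv hinjA).symm⟩⟩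
      g := fun A => ⟨((p : ℕ) : (base.obj A).K), (base.obj A).p_mem⟩ ^ 2 ^ A.val
      g_mem := fun A => ⟨1, by
        show (primGen base A ^ 2 ^ A.val) ^ 1 = Realification.of (OrdInt (base.obj A).K)
          (Associates.mk ((⟨((p : ℕ) : (base.obj A).K), (base.obj A).p_mem⟩ : intNonzero (base.obj A).K) ^ 2 ^ A.val))
        rw [pow_one, Associates.mk_pow, map_pow]
        rfl⟩
      g_not_isUnit := fun A h =>
        (base.obj A).p_lt.ne ((isUnit_intNonzero_iff _ _).mp ((isUnit_pow_iff (Nat.two_pow_pos _).ne').mp h)) }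
  refine ⟨T.toDatum hloc hc he, ?_, ?_⟩
  · -- absolutely primitive: `Φ(a) ⊆ ℤ · ord(p)`
    rintro A ⟨x, m, rfl⟩
    change _ ∈ ((T.toDatum hloc hc he).ordQpSubgroup A :
      Set (Algebra.GrothendieckGroup (Realification (OrdInt ((T.toDatum hloc hc he).fld A)))))
    rw [SetLike.mem_coe]
    refine Subgroup.mem_zpowers_iff.mpr ⟨((2 ^ A.val * m : ℕ) : ℤ), ?_⟩
    rw [zpow_natCast]
    show Algebra.GrothendieckGroup.of (primGen base A) ^ (2 ^ A.val * m) =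
      Algebra.GrothendieckGroup.of ((primGen base A ^ 2 ^ A.val) ^ m)
    rw [← pow_mul, map_pow]
  · -- the pull-back along `0 → 1` misses the generator of `Φ(0)`
    intro hsurj
    obtain ⟨z, hz⟩ := hsurj ⟨_, Submonoid.mem_powers _⟩
    obtain ⟨m, hm⟩ := z.2
    have hm' : (primGen base (1 : Fin 2) ^ 2 ^ (1 : Fin 2).val) ^ m = z.1 := hm
    have h1 := congrArg Subtype.val hz
    change phi0Map base _ z.1 = primGen base 0 ^ 2 ^ (0 : Fin 2).val at h1
    rw [← hm', map_pow, map_pow, phi0Map_primGen, ← pow_mul] at h1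
    have h2 := hinj _ h1
    change 2 ^ (1 : Fin 2).val * m = 2 ^ (0 : Fin 2).val at h2
    simp only [Fin.val_one, Fin.val_zero, pow_one, pow_zero] at h2
    omega

/-- **Remark 1.2.2 WITHOUT the constancy reading (R1) fails at this datum**: for the absolutely primitive
datum above, its nowhere-torsion section `u_D` over `1 + p` and the characteristic splitting `τ_p` of Thm.
1.2 (v) (`pSplitting`): `u_D · τ_p` is NOT (the family of) a characteristic splitting (sentence 3), and NO
morphism of the data `(Φ, B → Φ^gp)` is the identity on `O^×(−)` and maps `τ_p` to `u_D · τ_p` (sentence 4) —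
by `not_rmk122Twist_of_not_surjective` / `not_rmk122U_of_not_surjective` (`PadicFrobenioidRmk122Necessity`).
This is cell FINDING T4g2-F1's hand witness, kernel-checked. [cite: MochizukiFrdII2008, Rmk 1.2.2 p.10] -/
theorem exists_isAbsolutelyPrimitive_not_rmk122 :
    ∃ (d : Datum (Fin 2) p) (hap : d.IsAbsolutelyPrimitive) (s : d.UnitSection),
      (¬ ∃ T' : PreFrobenioid.CharacteristicSplitting d.structureFunctor,
          T'.τ = s.twist (d.pSplitting hap).τ) ∧
      ¬ ∃ U : ModelFrobenioid.DataHom d.divB d.divB,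
          d.FixesUnits U ∧ d.MapsSplittingTo U s (d.pSplitting hap).τ := by
  obtain ⟨d, hap, hf⟩ := exists_isAbsolutelyPrimitive_not_surjective p
  obtain ⟨s, hs⟩ := d.exists_unitSection_forall_pow_ne_one
  exact ⟨d, hap, s,
    fun ⟨T', hT'⟩ => hf (d.surjective_mapΦ_of_twist_characteristicSplitting hap _ s T' hT' _ (hs _)),
    fun ⟨U, hfix, hmaps⟩ => hf (d.surjective_mapΦ_of_fixesUnits_mapsSplittingTo hap _ s hfix hmaps _ (hs _))⟩

end Witness

/-- **Sentence 3 as printed (no (R1)) is FALSE**: it is not the case that for every absolutely primitive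
`p`-adic Frobenioid datum, every section `u_D` of `O^×(−)` and every characteristic splitting `τ`, the family
`u_D · τ` is again a characteristic splitting — i.e. the typed `Rmk122TwistOfBijective` with its
`HasBijectivePullbacks` binder deleted fails (closed form; witness at `p = 2`).
[cite: MochizukiFrdII2008, Rmk 1.2.2 p.10] -/
theorem not_forall_rmk122Twist_asPrinted :
    ¬ ∀ (D : Type) [Category.{0} D] (p : ℕ) [Fact p.Prime] (d : Datum D p), d.IsAbsolutelyPrimitive →
        ∀ (s : d.UnitSection) (T : PreFrobenioid.CharacteristicSplitting d.structureFunctor),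
          ∃ T' : PreFrobenioid.CharacteristicSplitting d.structureFunctor, T'.τ = s.twist T.τ := by
  intro h
  obtain ⟨d, hap, s, h3, -⟩ := exists_isAbsolutelyPrimitive_not_rmk122 2
  exact h3 (h (Fin 2) 2 d hap s (d.pSplitting hap))

/-- **Sentence 4 as printed (no (R1)) is FALSE**: it is not the case that for every absolutely primitive
datum, every section `u_D` and every characteristic splitting `τ` there is a morphism (let alone a unique
automorphism) of the data which is the identity on `O^×(−)` and maps `τ` to `u_D · τ` — the typed
`Rmk122UOfBijective` with its `HasBijectivePullbacks` binder deleted fails (closed form; witness at `p = 2`).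
[cite: MochizukiFrdII2008, Rmk 1.2.2 p.10] -/
theorem not_forall_rmk122U_asPrinted :
    ¬ ∀ (D : Type) [Category.{0} D] (p : ℕ) [Fact p.Prime] (d : Datum D p), d.IsAbsolutelyPrimitive →
        ∀ (s : d.UnitSection) (T : PreFrobenioid.CharacteristicSplitting d.structureFunctor),
          ∃ U : ModelFrobenioid.DataHom d.divB d.divB, d.FixesUnits U ∧ d.MapsSplittingTo U s T.τ := by
  intro h
  obtain ⟨d, hap, s, -, h4⟩ := exists_isAbsolutelyPrimitive_not_rmk122 2
  exact h4 (h (Fin 2) 2 d hap s (d.pSplitting hap))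

/-- **(R1) is NOT automatic for absolutely primitive data**: there is an absolutely primitive datum whose
pull-back maps on `Φ` are not all bijective (so `HasBijectivePullbacks` is a genuine hypothesis of the typed
statements, automatic only in the constant regime — e.g. `Datum.prim`, `prim_map_Φ_bijective`).
[cite: MochizukiFrdII2008, Ex 1.1 (ii) p.8] -/
theorem exists_isAbsolutelyPrimitive_not_hasBijectivePullbacks (p : ℕ) [Fact p.Prime] :
    ∃ d : Datum (Fin 2) p, d.IsAbsolutelyPrimitive ∧ ¬ d.HasBijectivePullbacks := by
  obtain ⟨d, hap, hf⟩ := exists_isAbsolutelyPrimitive_not_surjective p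
  exact ⟨d, hap, fun h => hf (h _).2⟩

end PadicFrd

end Literature.AlgebraicGeometry.Frobenioids
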